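import Summits.BirchSwinnertonDyer.BirchSwinnertonDyer.Theorems.EisensteinPrimesBSDpOnCellCTelescopeK2InertiaDefectFiniteOfFibres
import Summits.BirchSwinnertonDyer.BirchSwinnertonDyer.Theorems.EisensteinPrimesBSDpOnCellCTelescopeK2WeightTwoControlMapOfFiniteDefect
import Summits.BirchSwinnertonDyer.BirchSwinnertonDyer.Theorems.EisensteinPrimesBSDpOnCellCTelescopeK2FibreCofinite
import HarnessLib

/-!
# Crux 4 `BSDpOnCellC` (stmt-BirchSwinnertonDyer-19034), line `telescope`, leaf N2′ / sub-leaf W2 — road (a′) of the `S₀`-residual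
# COMPLETED IN FD CURRENCY: (fin_w) from N1's fibre data + (dist) «infinitely many distinct fibres» + triviality of `I_w` along the
# member fibre maps; and W2's control map with `S₀` ARBITRARY under those hypotheses
# (helper, `--supports stmt-BirchSwinnertonDyer-19034 --as helper`; closes nothing)

Cell `bsd-eis`, width seat `bsd-line-x2-p2` (prover g21, 2026-08-30; D-0154 KEY row 5). THEOREMS ONLY: no definition, no named fact,
no `sorry`, no instance, no notation. Assembly of this seat's p758349 `…WeightTwoControlMapOfFiniteDefect` (W2 ⟸ (deg₁)_w ∨ (fin_w)),
file A `…GenericFibreZero` (generic-fibre zero lemma over `ℤ_p⟦X⟧`) and file B `…InertiaDefectFiniteOfFibres` ((fin) from the fibre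
condition), in the binder currency of N1 `stub_branchLattice` / the N2 workfile `K2Weight2.stub_weightTwoControlMap` (telescope v10):

* §1 **`finite_image_sub_of_fixed`** — the FIBRE CONDITION from (fd_k)-shaped data: if `θ : A₂[π] →+ P` has finite kernel and
  `θ (ρ₂(σ) a) = θ a` on `A₂[π]` (equivariance of (fd_k) + `σ` acting trivially on the member `P = A_{g_k}†`, e.g. `σ ∈ I_w`,
  `w ∤ (N/p)·p`, `OrdinaryNewformDatum.charpoly`), then `(ρ₂(σ) − 1)(A₂[π])` is finite.
* §2 **`exists_pow_inertiaDefect_of_fd`** — (fin_w) «`∃ n, ∀ a ∈ A₂^{I_w}, ∃ a₀ ∈ A₂^{I_w}, X•a₀ = p^n•a`» from: (tor), (cof₀),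
  (fd₀: `θ₀` `ℤ_p`-semilinear with finite kernel, into `E[p^∞]` of an elliptic curve over a field of characteristic `≠ p`), a sequence
  `x` with `‖x k‖ < 1` and `x '' 𝒦` INFINITE ((dist) — `IsPNewBranchAnalyticChart` (wt) + `Tendsto x → 0` give it; NOT in the v10
  prefix), and for `k ∈ 𝒦` fibre maps `θ_k : A₂[X − C x_k] →+ P_k` with finite kernel along which every `h ∈ I_w` acts trivially.
  (`A₂` is cofinitely generated by `TelescopeK2FibreCofinite.isCofinitelyGenerated_of_fd`; `p`-primary by (tor) + (fd₀).)
* §3 **`exists_weightTwoControlMap_of_cellC_of_fibres`** — W2's conclusion in the N2-workfile currency with `S₀ : Set` finite and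
  ARBITRARY: p758349's `exists_weightTwoControlMap_of_cellC_of_finiteDefect` with its per-prime hypothesis (fin_w) at
  `w ∈ S₀ ∖ supp(N·p)` DISCHARGED by §2 from (dist) + the member-fibre triviality of `I_w` at those `w`.

BY NAME: the S₀-residual of host l.6517/l.6537 is reduced to (dist) + «for `w ∈ S₀`, `w ∤ N·p`, and `k ∈ 𝒦`, `I_w` acts trivially through
`θ_k`», both properties of the genuine data (distinct weights; members unramified at `w ∤ (N/p)·p`) but NEITHER typed in v10's prefix/FD —
exactly the clauses (dist)/(fin) proposed for v11 (evidence #46). Nothing about any curve's BSD is asserted; `ρ₂`, `θ₀`, `θ_k` are binders.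

HONEST FRAMING: assembly over binders; no registered stub, crux or summit statement is proved by this file; closes: none.

References: [GreenbergLNM1716] §4 p. 117; [Greenberg2006] §3 A; [JetchevSkinnerWan2017] §3.4 Lemma 3.4.1; [Castella2018Erratum] Lemma 2.1;
[SilvermanAEC2009] Cor. III.6.4(b); [Brink2007] Cor. 1; [Gross1991] §1.
-/

noncomputable section

-- D-0017: single-problem summit, the namespace repeats the problem name by design.
set_option linter.dupNamespace false
set_option autoImplicit false

open Field IsDedekindDomain NumberField WeierstrassCurve
open Literature.NumberTheory.GaloisRepresentations Literature.NumberTheory.EllipticCurves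
  Literature.NumberTheory.EllipticCurves.BigRepModule Literature.NumberTheory.EllipticCurves.BigGaloisRep
open Literature.NumberTheory.IwasawaTheory Literature.NumberTheory.IwasawaTheory.Greenberg2006
open Summit.BirchSwinnertonDyer.Rank1Residual.X11b

universe u

namespace Summit.BirchSwinnertonDyer.BirchSwinnertonDyer.Theorems.TelescopeK2InertiaDefectFiniteOfFibreData

variable {p : ℕ} [Fact p.Prime]

/-! ## §1 The fibre condition from an equivariant fibre map with finite kernel -/

/-- **The fibre condition from (fd)-shaped data.** If `θ : A₂[π] →+ P` has finite kernel and `θ (ρ₂(σ)·a) = θ a` for all `a ∈ A₂[π]`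
(equivariance of `θ` plus triviality of `σ` on the target), then `(ρ₂(σ) − 1)(A₂[π])` is a finite set (it lies in `ker θ`).
[cite: Greenberg2006, §3 A (p. 358)] -/
theorem finite_image_sub_of_fixed {Γ : Type u} [Group Γ] [TopologicalSpace Γ] {Λ : Type*} [CommRing Λ] [TopologicalSpace Λ]
    {A : Type u} [AddCommGroup A] [Module Λ A] [TopologicalSpace A]
    (ρ : ContinuousRep Γ Λ A) (π : Λ) {P : Type*} [AddCommGroup P]
    (θ : Submodule.torsionBy Λ A π →+ P) (hker : Finite θ.ker) (σ : Γ)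
    (hfix : ∀ a : Submodule.torsionBy Λ A π, θ (BigGaloisRep.torsionRep ρ π σ a) = θ a) :
    Set.Finite ((fun a => ρ σ a - a) '' {a : A | π • a = 0}) := by
  haveI := hker
  have hsub : (fun a => ρ σ a - a) '' {a : A | π • a = 0} ⊆
      (fun d : θ.ker => ((d : Submodule.torsionBy Λ A π) : A)) '' Set.univ := by
    rintro _ ⟨a, ha, rfl⟩
    let a' : Submodule.torsionBy Λ A π := ⟨a, (Submodule.mem_torsionBy_iff π a).2 ha⟩
    have hmem : BigGaloisRep.torsionRep ρ π σ a' - a' ∈ θ.ker := by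
      rw [AddMonoidHom.mem_ker, map_sub, hfix, sub_self]
    exact ⟨⟨_, hmem⟩, Set.mem_univ _, by simp [a']⟩
  exact (Set.finite_univ.image _).subset hsub

/-! ## §2 (fin_w) from N1's fibre data + (dist) + fibrewise triviality of `I_w` -/

/-- **(fin_w) IN FD CURRENCY.** For `ρ₂ : Γ_K → Aut_{ℤ_p⟦X⟧}(A₂)` with (tor), (cof₀), an (fd₀)-shaped `θ₀` (finite kernel, `ℤ_p`-semilinear,
into `E[p^∞]` of an elliptic curve over a field of characteristic `≠ p`), a sequence `x` with `‖x k‖ < 1` taking INFINITELY many values on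
`𝒦` ((dist)), and for `k ∈ 𝒦` fibre maps `θ_k : A₂[X − C x_k] →+ P_k` with finite kernel fixed by every `h ∈ I_w`
(`θ_k (ρ₂(h)·a) = θ_k a`): **`∃ n, ∀ a ∈ A₂^{I_w}, ∃ a₀ ∈ A₂^{I_w}, X•a₀ = p^n•a`** — the hypothesis (fin_w) of p758349.
[cite: GreenbergLNM1716, §4 p. 117] [cite: Greenberg2006, §3 A (Props. 3.1–3.2)] [cite: SilvermanAEC2009, Cor. III.6.4(b)] -/
theorem exists_pow_inertiaDefect_of_fd {K : Type} [Field K] [NumberField K]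
    {F : Type} [Field F] (E : WeierstrassCurve F) [E.IsElliptic] (hpF : (p : F) ≠ 0)
    [TopologicalSpace (PowerSeries ℤ_[p])] {A₂ : Type} [AddCommGroup A₂] [Module (PowerSeries ℤ_[p]) A₂]
    [TopologicalSpace A₂]
    (ρ₂ : ContinuousRep (absoluteGaloisGroup K) (PowerSeries ℤ_[p]) A₂)
    (htor : ∀ a : A₂, ∃ n : ℕ, (PowerSeries.X : PowerSeries ℤ_[p]) ^ n • a = 0)
    (hcof : ∀ a : A₂, ∃ b : A₂, (PowerSeries.X : PowerSeries ℤ_[p]) • b = a)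
    (θ₀ : Submodule.torsionBy (PowerSeries ℤ_[p]) A₂ (PowerSeries.X : PowerSeries ℤ_[p]) →+ PrimaryTorsion E.geomPoints p)
    (hθ₀ : ∀ (c : ℤ_[p]) (a : Submodule.torsionBy (PowerSeries ℤ_[p]) A₂ (PowerSeries.X : PowerSeries ℤ_[p])),
      θ₀ (PowerSeries.C c • a) = c • θ₀ a)
    (hker₀ : Finite θ₀.ker)
    (x : ℕ → ℤ_[p]) (hx : ∀ k, ‖x k‖ < 1) (𝒦 : Set ℕ) (h𝒦 : (x '' 𝒦).Infinite)
    {P : ℕ → Type*} [∀ k, AddCommGroup (P k)]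
    (θ : ∀ k, Submodule.torsionBy (PowerSeries ℤ_[p]) A₂ (PowerSeries.X - PowerSeries.C (x k)) →+ P k)
    (hker : ∀ k ∈ 𝒦, Finite (θ k).ker)
    (w : HeightOneSpectrum (𝓞 K))
    (hfix : ∀ k ∈ 𝒦, ∀ (h : LocalGroup K (Sum.inr w))
      (a : Submodule.torsionBy (PowerSeries ℤ_[p]) A₂ (PowerSeries.X - PowerSeries.C (x k))),
      θ k (BigGaloisRep.torsionRep ρ₂ _ (localMap K (Sum.inr w) h) a) = θ k a) :
    ∃ n : ℕ, ∀ a : A₂, (∀ h : LocalGroup K (Sum.inr w), ρ₂ (localMap K (Sum.inr w) h) a = a) →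
      ∃ a₀ : A₂, (∀ h : LocalGroup K (Sum.inr w), ρ₂ (localMap K (Sum.inr w) h) a₀ = a₀) ∧
        (PowerSeries.X : PowerSeries ℤ_[p]) • a₀ = ((p : PowerSeries ℤ_[p]) ^ n) • a := by
  classical
  -- `A₂` cofinitely generated (Greenberg's criterion, (tor) + (fd₀)) and `p`-primary
  have hA : IsCofinitelyGenerated (PowerSeries ℤ_[p]) A₂ :=
    TelescopeK2FibreCofinite.isCofinitelyGenerated_of_fd TelescopeK2FibreCofinite.primaryTorsion_exists_pow_smul_eq_zero
      (TelescopeK2FibreCofinite.finite_torsionBy_primaryTorsion_geomPoints E hpF) htor θ₀ hθ₀ hker₀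
  have hPT : ∀ e : PrimaryTorsion E.geomPoints p, IsOfFinAddOrder e := fun e => by
    obtain ⟨k, hk⟩ := PrimaryTorsion.exists_pow_smul_eq_zero e
    refine (isOfFinAddOrder_iff_nsmul_eq_zero).2 ⟨p ^ k, pow_pos (Nat.Prime.pos Fact.out) k, ?_⟩
    apply PrimaryTorsion.ext
    rw [PrimaryTorsion.val_nsmul, hk, PrimaryTorsion.val_zero]
  have htors : ∀ a : A₂, IsOfFinAddOrder a :=
    TelescopeK2BigRepDivisible.isOfFinAddOrder_of_pow_torsion PowerSeries.X htor
      (TelescopeK2BigRepDivisible.isOfFinAddOrder_of_torsionBy PowerSeries.X θ₀ hker₀ hPT)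
  have hprim : ∀ a : A₂, ∃ k : ℕ, (p : PowerSeries ℤ_[p]) ^ k • a = 0 := fun a => by
    obtain ⟨k, hk⟩ := TelescopeK2WeightTwoControlMapOfFrobenius.exists_pow_smul_eq_zero_of_isOfFinAddOrder (p := p) (htors a)
    refine ⟨k, ?_⟩
    rw [← Nat.cast_pow, Nat.cast_smul_eq_nsmul, hk]
  -- the fibre condition on `𝒦` (§1), then file B §5 at `c = 0`
  have hfib : ∀ k ∈ 𝒦, ∀ h : LocalGroup K (Sum.inr w),
      Set.Finite ((fun a => ρ₂ (localMap K (Sum.inr w) h) a - a) ''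
        {a : A₂ | (PowerSeries.X - PowerSeries.C (x k)) • a = 0}) := fun k hk h =>
    finite_image_sub_of_fixed ρ₂ _ (θ k) (hker k hk) _ (hfix k hk h)
  have h0 : (0 : ℤ_[p]) ∈ IsLocalRing.maximalIdeal ℤ_[p] := Ideal.zero_mem _
  have hdiv0 : ∀ a : A₂, ∃ b : A₂, (PowerSeries.X - PowerSeries.C (0 : ℤ_[p])) • b = a := by
    intro a
    rw [map_zero, sub_zero]
    exact hcof a
  obtain ⟨n, hn⟩ := TelescopeK2InertiaDefectFiniteOfFibres.exists_pow_inertiaDefect_of_fibres ρ₂ hA hprim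
    (fun h : LocalGroup K (Sum.inr w) => localMap K (Sum.inr w) h) x hx 𝒦 h𝒦 hfib h0 hdiv0
  refine ⟨n, fun a ha => ?_⟩
  obtain ⟨a₀, ha₀, h⟩ := hn a ha
  refine ⟨a₀, ha₀, ?_⟩
  rwa [map_zero, sub_zero] at h

/-! ## §3 W2 with `S₀` arbitrary, the residual discharged from (dist) + member-fibre triviality of `I_w` -/

/-- **SUB-LEAF W2, `S₀` ARBITRARY, road (a′) closed by name**: p758349's `exists_weightTwoControlMap_of_cellC_of_finiteDefect` with its
per-prime hypothesis (fin_w) at `w ∈ S₀ ∖ supp(N·p)` DISCHARGED by §2 from (dist) «`x '' 𝒦` infinite» and member fibre maps `θ_k`,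
`k ∈ 𝒦`, with finite kernel along which every `h ∈ I_w` acts trivially, at each such `w`. All other binders = the N2 workfile's W2.
[cite: JetchevSkinnerWan2017, §3.4, Lemma 3.4.1 (arXiv:1512.06894 p. 14)] [cite: Castella2018Erratum, Lemma 2.1 (p. 2)]
[cite: GreenbergLNM1716, §4 p. 117] [cite: Gross1991, §1] [cite: Brink2007, Cor. 1] -/
theorem exists_weightTwoControlMap_of_cellC_of_fibres {K : Type} [Field K] [NumberField K]
    (W : WeierstrassCurve ℚ) [W.IsElliptic] [W.IsGloballyMinimal] (hc : Rank1Residual.X2.CellC W p)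
    {N : ℕ} [NeZero N] (hK : IsImaginaryQuadratic K) (hHeeg : SatisfiesHeegnerHypothesis N K)
    (hsp : ((Ideal.span {(p : ℤ)}).primesOver (𝓞 K)).ncard = 2)
    (κ : ZpExtension K p) (hκ : κ.IsAnticyclotomic)
    (𝔭bar : HeightOneSpectrum (𝓞 K)) (h𝔭bar : ((p : ℕ) : 𝓞 K) ∈ 𝔭bar.asIdeal)
    [TopologicalSpace (PowerSeries ℤ_[p])] (A₂ : Type) [AddCommGroup A₂] [Module (PowerSeries ℤ_[p]) A₂]
    [TopologicalSpace A₂] [DiscreteTopology A₂]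
    (ρ₂ : ContinuousRep (absoluteGaloisGroup K) (PowerSeries ℤ_[p]) A₂)
    [TopologicalSpace (PowerSeries (PowerSeries ℤ_[p]))]
    [ContinuousSMul (PowerSeries (PowerSeries ℤ_[p])) (BigRepModule (PowerSeries ℤ_[p]) p A₂)]
    (htor : ∀ a : A₂, ∃ n : ℕ, (PowerSeries.X : PowerSeries ℤ_[p]) ^ n • a = 0)
    (hcof : ∀ a : A₂, ∃ b : A₂, (PowerSeries.X : PowerSeries ℤ_[p]) • b = a)
    (S₀ : Set (HeightOneSpectrum (𝓞 K))) (hS₀ : S₀.Finite) (hunr : GaloisRep.IsUnramifiedOutside S₀ ρ₂)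
    (θ₀ : Submodule.torsionBy (PowerSeries ℤ_[p]) A₂ (PowerSeries.X : PowerSeries ℤ_[p]) →+
      PrimaryTorsion (W.baseChange K).geomPoints p)
    (hθ₀ : ∀ (c : ℤ_[p]) (a : Submodule.torsionBy (PowerSeries ℤ_[p]) A₂ (PowerSeries.X : PowerSeries ℤ_[p])),
      θ₀ (PowerSeries.C c • a) = c • θ₀ a)
    (hθσ : ∀ (σ : absoluteGaloisGroup K)
      (a : Submodule.torsionBy (PowerSeries ℤ_[p]) A₂ (PowerSeries.X : PowerSeries ℤ_[p])),
      θ₀ (BigGaloisRep.torsionRep ρ₂ (PowerSeries.X : PowerSeries ℤ_[p]) σ a) =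
        (W.baseChange K).primaryTorsionGaloisRep p σ (θ₀ a))
    (hker : Finite θ₀.ker)
    -- (dist) and the member fibre maps at the primes of `S₀` away from `N·p`
    (x : ℕ → ℤ_[p]) (hx : ∀ k, ‖x k‖ < 1) (𝒦 : Set ℕ) (h𝒦 : (x '' 𝒦).Infinite)
    {P : ℕ → Type*} [∀ k, AddCommGroup (P k)]
    (θ : ∀ k, Submodule.torsionBy (PowerSeries ℤ_[p]) A₂ (PowerSeries.X - PowerSeries.C (x k)) →+ P k)
    (hkerk : ∀ k ∈ 𝒦, Finite (θ k).ker)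
    (hfix : ∀ w ∈ S₀, ((p : ℕ) : 𝓞 K) ∉ w.asIdeal → ((N : ℕ) : 𝓞 K) ∉ w.asIdeal →
      ∀ k ∈ 𝒦, ∀ (h : LocalGroup K (Sum.inr w))
        (a : Submodule.torsionBy (PowerSeries ℤ_[p]) A₂ (PowerSeries.X - PowerSeries.C (x k))),
        θ k (BigGaloisRep.torsionRep ρ₂ _ (localMap K (Sum.inr w) h) a) = θ k a) :
    ∃ α : QuotSMulTop (PowerSeries.C (PowerSeries.X : PowerSeries ℤ_[p])) (XBig κ ρ₂ 𝔭bar (∅ : Set (HeightOneSpectrum (𝓞 K))))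
        →ₗ[PowerSeries (PowerSeries ℤ_[p])]
        CharacterModule (TorsionControl.selmer (localMap K) (strictSet p 𝔭bar (∅ : Set (HeightOneSpectrum (𝓞 K))))
          (TorsionControl.torsionRep (AnticyclotomicBigGaloisRep κ ρ₂) (PowerSeries.C (PowerSeries.X : PowerSeries ℤ_[p])))),
      (∀ m ∈ LinearMap.ker α, ∃ s : PowerSeries (PowerSeries ℤ_[p]),
        ¬ ((PowerSeries.C (PowerSeries.X : PowerSeries ℤ_[p])) ∣ s) ∧ s • m = 0) ∧
      Finite ((CharacterModule (TorsionControl.selmer (localMap K) (strictSet p 𝔭bar (∅ : Set (HeightOneSpectrum (𝓞 K))))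
        (TorsionControl.torsionRep (AnticyclotomicBigGaloisRep κ ρ₂) (PowerSeries.C (PowerSeries.X : PowerSeries ℤ_[p]))))) ⧸
          LinearMap.range α) := by
  have hpK : (p : K) ≠ 0 := Nat.cast_ne_zero.2 (Nat.Prime.ne_zero Fact.out)
  exact TelescopeK2WeightTwoControlMapOfFiniteDefect.exists_weightTwoControlMap_of_cellC_of_finiteDefect W hc hK hHeeg hsp κ hκ
    𝔭bar h𝔭bar A₂ ρ₂ htor hcof S₀ hS₀ hunr θ₀ hθσ hker fun w hw hpw hNw =>
      exists_pow_inertiaDefect_of_fd (W.baseChange K) hpK ρ₂ htor hcof θ₀ hθ₀ hker x hx 𝒦 h𝒦 θ hkerk w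
        (hfix w hw hpw hNw)

end Summit.BirchSwinnertonDyer.BirchSwinnertonDyer.Theorems.TelescopeK2InertiaDefectFiniteOfFibreData

end
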